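import Summits.FinalStateConjecture.FinalStateConjecture.Theses.RecedingSphereBudgets
import HarnessLib

/-!
# Birth skeleton — crux stmt-FinalStateConjecture-17690 `Theses.RecedingSphereBudgets.Reanchoring` (R, crux rank 9)
# line `birth` (skeleton registrar planner-skel-stmt-FinalStateConjecture-17690-0, 2026-08-17; BC3 of run/shared/lean/lens3/_common/BC.md)

R (RE-ANCHORING): for every admissible datum, every MGHD with complete `𝓘⁺` and every shape-settled final era with
DRIFTING labels `Q′` (the route's rev-14 hypothesis block, verbatim: `N` hole charts `Ψ i` on the collars
`U i = {r_{a(t)} > r₊(M(t),a(t)) − δ₀}` of boosted Kerr–Schild coordinates with adiabatic labels `(Mᵢ(t), aᵢ(t))`, one flat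
chart `Ψ₀`, the self-determined region `O`, `Cᵏ` collar convergence for every `k`, separation, excision, chart localisation,
rays, orientation and the exhaustiveness clause (E)), IF every label converges THEN there are `O′` and a `C²`
`FinalStateDecomposition d` of `O′` with sub-extremal holes, `O′ = exteriorOf 𝒟 d.charted`, `RaysStayInClosure 𝒟 O′`,
`HasExhaustiveCharts d` (honest radii) and `IsFutureOriented d` — verbatim the conjunction the Statement asks of every MGHD.

The cut follows the planner's own construction recorded on the item (informal text of stmt-17690: `d.mass/spin` = the limits,
`d.chart i = Ψ i ∘ Φ i` with `Φ i` the radial graph map straightening `𝓗⁺ = ∂O ∩ (collar image)` to `{r∞ = r₊(Mᵢ∞, aᵢ∞)}`,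
identity for `r∞ ≥ r₊∞ + 1`, `Φ i → id` in `C³`; flat chart, motions and excision radii unchanged; `d.τ₀` a late time; honest
radii by the diagonal argument) and separates its three kinds of mathematics:

* `stub_horizonStraightening` (H — HORIZON NORMALISATION; XL, the load-bearing stub): under `Q′` with labels converging to
  `(Mc, ac)` there are a late hole time `τ₁ ≥ τ₀` and smooth, hole-time-preserving maps `Φ i : E4 → E4`, equal to the identity
  outside the unit shell above the frozen horizon (at late times), mapping the frozen exterior `F i = boostedKerrExterior … (Mc i) (ac i)`
  into the collar `U i`, open embeddings on the late frozen exterior, `Φ i − id → 0` in `C³` on every truncated frozen slab, and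
  — the anchoring — `Ψ i (Φ i (late frozen exterior)) = O ∩ Ψ i (late collar)`: inside the late collar image, `O` is EXACTLY the
  straightened exterior.  Content: `O` contains no black-hole/horizon point ((E) + the red-shift bound on how long a causal curve can
  stay in the collar below the horizon), the d.o.c. sliver between `𝓗⁺` and `{r = r₊(M(t),a(t))}` lies in `O`, and the late event
  horizon is a `C^∞` radial graph converging to the Kerr horizon in `C³` (stable manifold of the horizon-generator flow, `κ(Mc, ac) > 0`,
  fed by `Q′`'s `Cᵏ` collar convergence for every `k`).  Why it might fail: generator regularity is stable-manifold theory for a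
  non-autonomous, merely asymptotically Kerr null geodesic flow (finite smoothness / shrinking neighbourhoods would break `C^∞` or the
  uniform `C³` rate); `O ∩ (collar) = {r > r_H}` needs near-horizon causal bookkeeping at late times that is nowhere in Lean.
* `stub_frozenTransport` (T — ADIABATIC-TO-FROZEN TRANSPORT; L): given `Q′`, the limits and such `Φ`, the re-anchored charts
  `Ψ′ i := Ψ i ∘ Φ i` on the frozen exteriors and the unchanged flat chart form, from some late `τ₂`, a FROZEN ANCHORED ERA: exactly
  the field list of `FinalStateDecomposition` for the region `O′ := exteriorOf 𝒟 (Ψ₀ '' {x⁰ > τ₂} ∪ ⋃ᵢ Ψ′ i '' {t*ᵢ > τ₂})` in `C²`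
  (late charts into `O′`, truncated `C²` convergence to the FROZEN boosted Kerr–Schild background for every radius, separation,
  sublinear excision with the Kerr–Schild radius, flat `C²` convergence, covering at `τ₂`), plus the Statement-side clauses in frozen
  currency: `Q′`-shaped exhaustiveness of `O′` (some radii, no honesty claimed), future orientation along `Λᵢ V_{Mc,ac}` and `∂₀`,
  orthochronous motions, the box inequalities of the limits, and the rays clause for `exteriorOf 𝒟 (Ψ₀ '' {x⁰ > τ₂})`.  Content: `C²`
  estimates of pull-backs under `C³`-near-identity reparametrisations + joint smoothness of the Kerr–Schild field in `(M, a, x)` + label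
  convergence; openness of late images (`W ⊆ I⁻(W)`); `Kerr.radius a y ≤ ‖y̲‖`; and the TRANSPORT OF (E) from the drifting collar charts
  to the straightened charts (cases: flat-certified / collar-certified inside `O` (anchoring + injectivity + radius comparison) /
  certified through a collar slab point OUTSIDE `O`, i.e. on or behind the horizon — the delicate case, settled by near-horizon
  causal geometry at late times).  Why it might fail: the last case (certification of a point of `O′` only through black-hole slab
  points) needs a uniform Gaussian-null neighbourhood of the late horizon; `Q′`'s thresholds are per-radius "eventually", so every
  argument must be run at a fixed bounded radius.
* `stub_packageDecomposition` (P — PACKAGING + HONEST RADII; M, provable now): a frozen anchored era packages into the conclusion: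
  `d := ⟨N, Mc, ac, …, motion, τ₂, Ψ′, …, ρ, …, U₀, …, Ψ₀, …⟩`, sub-extremality from `m₀ ≤ Mc i`, `|ac i| ≤ χ Mc i`, `χ < 1`;
  `O′ = exteriorOf 𝒟 d.charted` definitionally; rays by monotonicity of `closure ∘ exteriorOf`; `IsFutureOriented` by `Iff.rfl` on
  `IsOrthochronous` and the two orientation clauses; `HasExhaustiveCharts` from the `Q′`-shaped clause UPGRADED to honest growing radii
  `R′ ≥ max(r₊, 0) + 1`, `R′ → ∞` by the diagonal argument over the fixed-radius convergence (`truncDeviationCk_mono`, sup over a union of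
  truncations, monotonicity of both sides of the causal clause in the radius).  Why it might fail: only Lean plumbing (19-field structure,
  `let`-unfolding of `d.background`, `ENNReal` diagonalisation).

Composition `Reanchoring_of : Sig.stub_horizonStraightening → Sig.stub_frozenTransport → Sig.stub_packageDecomposition → Reanchoring`
(`choose` the limits, apply H, then T, then P; the `Sig.*` legend = the stub signatures verbatim, so the implication has named
binders; the registered stubs themselves are DEF-FREE and self-contained via `open … in`), and `reanchoring_of_stubs : Reanchoring`
= the crux BY NAME, closed modulo the three stubs.  Disproof.lean: none exists for this crux (`ledger crux ls` empty at registration; no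
`_false_without_` obligations).  Negatives index (1 entry, `not_UniformPhotonSphereChannels`): unrelated ODE channel estimate.
Registered-signature note: H and T exceed the ledger's 3900-character stub record (the shared `Q′` block alone is 3.5 k); the
authoritative signatures are the ones in this file (`ledger … --from-file`).
-/

set_option linter.dupNamespace false

noncomputable section

open scoped Manifold ContDiff Topology ENNReal
open Filter Set Function Topology TopologicalSpace Literature.Geometry.Lorentzian

namespace Summit.FinalStateConjecture.FinalStateConjecture.Cruxes.Reanchoring.Birth

open Summit.FinalStateConjecture.FinalStateConjecture.Theses.RecedingSphereBudgets (Reanchoring)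

/-! ## Legend: the three stub statements as named propositions (verbatim the registered signatures) -/

/-- Statement of `stub_horizonStraightening` (H): `Q′` + label convergence ⇒ a late straightening package `(τ₁, Φ)` anchored
to `O` (clauses (1)–(7) of the docstring of the stub). -/
def Sig.stub_horizonStraightening : Prop :=
  open Literature.Geometry.Lorentzian Summit.FinalStateConjecture in ∀ (X : Type) [TopologicalSpace X] [ChartedSpace E3 X] [IsManifold (𝓡 3) (⊤ : ℕ∞) X] [T2Space X] [SecondCountableTopology X] [ConnectedSpace X], ∀ D ∈ admissibleVacuumData X, ∀ 𝒟 : VacuumCauchyDevelopment D, 𝒟.IsMaximal → HasCompleteNullInfinity 𝒟.toCauchyDevelopment → ∀ (N : ℕ) (m₀ χ τ₀ δ₀ : ℝ) (M a : Fin N → ℝ → ℝ) (motion : Fin N → lorentzGroup × E4) (U : Fin N → Opens E4) (Ψ : ∀ i, U i → 𝒟.carrier) (ρ : Fin N → ℝ → ℝ) (U₀ : Opens E4) (Ψ₀ : U₀ → 𝒟.carrier) (O : Set 𝒟.carrier), (let S := 𝒟.toSpacetime; let 𝒞 := 𝒟.toCauchyDevelopment; let J := 𝒟.metric.causalPast 𝒟.timeOrientation;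 let L := fun i ↦ ((motion i).1 : E4 ≃L[ℝ] E4); let p := fun i ↦ poincareInv (motion i).1 (motion i).2; let e := fun i ↦ L i (E4.basisVector 0); let B : Fin N → ModelBackground := fun i ↦ ⟨U i, fun x ↦ boostedKerrBilin (motion i).1 (motion i).2 (M i (p i x 0)) (a i (p i x 0)) x, fun x ↦ p i x 0, fun x ↦ Kerr.radius (a i (p i x 0)) (p i x)⟩; let ξ := fun i (t : ℝ) ↦ E4.spatial (((t - (motion i).2 0) / e i 0) • e i + (motion i).2); let B₀ := Minkowski.backgroundOn U₀; let h := S.deviationExtend B₀ Ψ₀; let ext := fun i ↦ (B i).lateRegion τ₀ ∩ {x | Kerr.rPlus (M i (p i x.1 0)) (a i (p i x.1 0)) < (B i).radius x.1}; (0 < m₀ ∧ 0 ≤ χ ∧ χ < 1 ∧ 0 < δ₀ ∧ 2 * δ₀ < m₀) ∧ (∀ i, ContDiff ℝ (⊤ : ℕ∞) (M i) ∧ ContDiff ℝ (⊤ : ℕ∞) (a i) ∧ (∀ t, m₀ ≤ M i t ∧ M i t ≤ m₀⁻¹ ∧ |a i t| ≤ χ * M i t) ∧ ∀ n : ℕ,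 1 ≤ n → Tendsto (iteratedDeriv n (M i)) atTop (𝓝 0) ∧ Tendsto (iteratedDeriv n (a i)) atTop (𝓝 0)) ∧ (∀ i, 0 < e i 0) ∧ Function.Injective e ∧ (∀ i, (U i : Set E4) = p i ⁻¹' {y : E4 | Kerr.rPlus (M i (y 0)) (a i (y 0)) - δ₀ < Kerr.radius (a i (y 0)) y}) ∧ (∀ i, S.IsLateChart (B i) Set.univ τ₀ (Ψ i) ∧ Ψ i '' ext i ⊆ O) ∧ (∀ i (k : ℕ) (R : ℝ), Tendsto (S.truncDeviationCk (B i) (Ψ i) k R) atTop (𝓝 0)) ∧ (∀ R : ℝ, ∃ τ₁, Pairwise (Disjoint on fun i ↦ Ψ i '' (B i).truncLateRegion τ₁ R)) ∧ (∀ i, Tendsto (fun t ↦ ρ i t / t) atTop (𝓝 0)) ∧ {x : E4 | τ₀ < x 0 ∧ ∀ i, ρ i (x 0) < E4.spatialNorm (p i x)} ⊆ ↑U₀ ∧ S.IsLateChart B₀ O τ₀ Ψ₀ ∧ Tendsto (S.deviationCk B₀ Ψ₀ 2) atTop (𝓝 0) ∧ O = exteriorOf 𝒞 (Ψ₀ ''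 B₀.lateRegion τ₀ ∪ ⋃ i, Ψ i '' ext i) ∧ (∀ τ₁ ≥ τ₀, RaysStayInClosure 𝒞 (exteriorOf 𝒞 (Ψ₀ '' B₀.lateRegion τ₁))) ∧ (∀ i (ϱ : ℝ), ∀ᶠ τ in atTop, ∀ x ∈ (B i).truncTimeSlab ϱ τ, 𝒟.timeOrientation.IsFutureDirected (mfderiv 𝓘(ℝ, E4) (𝓡 4) (Ψ i) x (L i (Kerr.timeVector (M i (p i x.1 0)) (a i (p i x.1 0)) (p i x.1))))) ∧ (∀ᶠ τ in atTop, ∀ x ∈ B₀.timeSlab τ, 𝒟.timeOrientation.IsFutureDirected (mfderiv 𝓘(ℝ, E4) (𝓡 4) Ψ₀ x (E4.basisVector 0))) ∧ O \ ((⋃ i, Ψ i '' (B i).lateRegion τ₀) ∪ Ψ₀ '' B₀.lateRegion τ₀) ⊆ J ((⋃ i, Ψ i '' (B i).timeSlab τ₀) ∪ Ψ₀ '' B₀.timeSlab τ₀) ∧ (∃ C₁ C₂ : ℝ, ∀ i (x : U i) (y : U₀), τ₀ < (B i).time x.1 → Ψ i x = Ψ₀ y → ‖E4.spatial y.1 -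 ξ i (y.1 0)‖ ≤ C₂ * (B i).radius x.1 + C₁) ∧ (∃ C_W : ℝ, ∀ᶠ τ in atTop, ∀ x : U₀, x.1 0 = τ → let w := 1 + ⨅ i, ‖E4.spatial x.1 - ξ i τ‖; w ^ (9 / 10 : ℝ) * ‖h x.1‖ ≤ C_W ∧ ∀ m : ℕ, 1 ≤ m → m ≤ 2 → w * ‖iteratedFDeriv ℝ m h x.1‖ ≤ C_W) ∧ (∃ C_E : ℝ, ∀ᶠ τ in atTop, ∫⁻ y in {y : E3 | E4.ofTimeSpace τ y ∈ U₀}, ‖iteratedFDeriv ℝ 1 h (E4.ofTimeSpace τ y)‖ₑ ^ 2 ≤ ENNReal.ofReal C_E) ∧ ∃ R : Fin N → ℝ → ℝ, (∀ i, Tendsto (fun τ ↦ S.truncDeviationCk (B i) (Ψ i) 2 (R i τ) τ) atTop (𝓝 0)) ∧ ∀ τ₁ > τ₀, O \ (Ψ₀ '' B₀.lateRegion τ₁ ∪ ⋃ i, Ψ i '' {x | τ₁ < (B i).time x.1 ∧ (B i).radius x.1 ≤ R i ((B i).time x.1)}) ⊆ J (Ψ₀ '' B₀.timeSlab τ₁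 ∪ ⋃ i, Ψ i '' (B i).truncTimeSlab (R i τ₁) τ₁)) → ∀ (Mc ac : Fin N → ℝ), (∀ i, Tendsto (M i) atTop (𝓝 (Mc i))) → (∀ i, Tendsto (a i) atTop (𝓝 (ac i))) → ∃ (τ₁ : ℝ) (Φ : Fin N → E4 → E4), τ₀ ≤ τ₁ ∧ (let p := fun i ↦ poincareInv (motion i).1 (motion i).2; let B : Fin N → ModelBackground := fun i ↦ ⟨U i, fun x ↦ boostedKerrBilin (motion i).1 (motion i).2 (M i (p i x 0)) (a i (p i x 0)) x, fun x ↦ p i x 0, fun x ↦ Kerr.radius (a i (p i x 0)) (p i x)⟩; let F : Fin N → Set E4 := fun i ↦ ↑(boostedKerrExterior (motion i).1 (motion i).2 (Mc i) (ac i)); ∀ i, ContDiff ℝ (⊤ : ℕ∞) (Φ i) ∧ (∀ x, p i (Φ i x) 0 = p i x 0) ∧ (∀ x, τ₁ < p i x 0 → Kerr.rPlus (Mc i) (ac i) + 1 ≤ Kerr.radius (ac i) (p i x) → Φ i x = x) ∧ Set.MapsTo (Φ i) (F i) (U i : Set E4) ∧ IsOpenEmbedding ((F i ∩ {x | τ₁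 < p i x 0}).restrict (Φ i)) ∧ (∀ R : ℝ, Tendsto (fun τ ↦ supCkENorm (F i ∩ {x | p i x 0 = τ ∧ Kerr.radius (ac i) (p i x) ≤ R}) 3 (fun x ↦ Φ i x - x)) atTop (𝓝 0)) ∧ Ψ i '' {y : U i | (y : E4) ∈ Φ i '' (F i ∩ {x | τ₁ < p i x 0})} = O ∩ Ψ i '' (B i).lateRegion τ₁)

/-- Statement of `stub_frozenTransport` (T): `Q′` + label limits + a straightening package ⇒ a frozen anchored era
`(τ₂, Ψ′)` for `O′ = exteriorOf 𝒟 (new charted late region)`. -/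
def Sig.stub_frozenTransport : Prop :=
  open Literature.Geometry.Lorentzian Summit.FinalStateConjecture in ∀ (X : Type) [TopologicalSpace X] [ChartedSpace E3 X] [IsManifold (𝓡 3) (⊤ : ℕ∞) X] [T2Space X] [SecondCountableTopology X] [ConnectedSpace X], ∀ D ∈ admissibleVacuumData X, ∀ 𝒟 : VacuumCauchyDevelopment D, 𝒟.IsMaximal → HasCompleteNullInfinity 𝒟.toCauchyDevelopment → ∀ (N : ℕ) (m₀ χ τ₀ δ₀ : ℝ) (M a : Fin N → ℝ → ℝ) (motion : Fin N → lorentzGroup × E4) (U : Fin N → Opens E4) (Ψ : ∀ i, U i → 𝒟.carrier) (ρ : Fin N → ℝ → ℝ) (U₀ : Opens E4) (Ψ₀ : U₀ → 𝒟.carrier) (O : Set 𝒟.carrier), (let S := 𝒟.toSpacetime; let 𝒞 := 𝒟.toCauchyDevelopment; let J := 𝒟.metric.causalPast 𝒟.timeOrientation; let L := fun i ↦ ((motion i).1 : E4 ≃L[ℝ] E4); let p := fun i ↦ poincareInv (motion i).1 (motion i).2; let e := fun i ↦ L i (E4.basisVector 0); let B : Fin N → ModelBackground := fun i ↦ ⟨U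 i, fun x ↦ boostedKerrBilin (motion i).1 (motion i).2 (M i (p i x 0)) (a i (p i x 0)) x, fun x ↦ p i x 0, fun x ↦ Kerr.radius (a i (p i x 0)) (p i x)⟩; let ξ := fun i (t : ℝ) ↦ E4.spatial (((t - (motion i).2 0) / e i 0) • e i + (motion i).2); let B₀ := Minkowski.backgroundOn U₀; let h := S.deviationExtend B₀ Ψ₀; let ext := fun i ↦ (B i).lateRegion τ₀ ∩ {x | Kerr.rPlus (M i (p i x.1 0)) (a i (p i x.1 0)) < (B i).radius x.1}; (0 < m₀ ∧ 0 ≤ χ ∧ χ < 1 ∧ 0 < δ₀ ∧ 2 * δ₀ < m₀) ∧ (∀ i, ContDiff ℝ (⊤ : ℕ∞) (M i) ∧ ContDiff ℝ (⊤ : ℕ∞) (a i) ∧ (∀ t, m₀ ≤ M i t ∧ M i t ≤ m₀⁻¹ ∧ |a i t| ≤ χ * M i t) ∧ ∀ n : ℕ, 1 ≤ n → Tendsto (iteratedDeriv n (M i)) atTop (𝓝 0) ∧ Tendsto (iteratedDeriv n (a i)) atTop (𝓝 0)) ∧ (∀ i, 0 < e i 0) ∧ Function.Injective e ∧ (∀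 i, (U i : Set E4) = p i ⁻¹' {y : E4 | Kerr.rPlus (M i (y 0)) (a i (y 0)) - δ₀ < Kerr.radius (a i (y 0)) y}) ∧ (∀ i, S.IsLateChart (B i) Set.univ τ₀ (Ψ i) ∧ Ψ i '' ext i ⊆ O) ∧ (∀ i (k : ℕ) (R : ℝ), Tendsto (S.truncDeviationCk (B i) (Ψ i) k R) atTop (𝓝 0)) ∧ (∀ R : ℝ, ∃ τ₁, Pairwise (Disjoint on fun i ↦ Ψ i '' (B i).truncLateRegion τ₁ R)) ∧ (∀ i, Tendsto (fun t ↦ ρ i t / t) atTop (𝓝 0)) ∧ {x : E4 | τ₀ < x 0 ∧ ∀ i, ρ i (x 0) < E4.spatialNorm (p i x)} ⊆ ↑U₀ ∧ S.IsLateChart B₀ O τ₀ Ψ₀ ∧ Tendsto (S.deviationCk B₀ Ψ₀ 2) atTop (𝓝 0) ∧ O = exteriorOf 𝒞 (Ψ₀ '' B₀.lateRegion τ₀ ∪ ⋃ i, Ψ i '' ext i) ∧ (∀ τ₁ ≥ τ₀, RaysStayInClosure 𝒞 (exteriorOf 𝒞 (Ψ₀ '' B₀.lateRegion τ₁))) ∧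 (∀ i (ϱ : ℝ), ∀ᶠ τ in atTop, ∀ x ∈ (B i).truncTimeSlab ϱ τ, 𝒟.timeOrientation.IsFutureDirected (mfderiv 𝓘(ℝ, E4) (𝓡 4) (Ψ i) x (L i (Kerr.timeVector (M i (p i x.1 0)) (a i (p i x.1 0)) (p i x.1))))) ∧ (∀ᶠ τ in atTop, ∀ x ∈ B₀.timeSlab τ, 𝒟.timeOrientation.IsFutureDirected (mfderiv 𝓘(ℝ, E4) (𝓡 4) Ψ₀ x (E4.basisVector 0))) ∧ O \ ((⋃ i, Ψ i '' (B i).lateRegion τ₀) ∪ Ψ₀ '' B₀.lateRegion τ₀) ⊆ J ((⋃ i, Ψ i '' (B i).timeSlab τ₀) ∪ Ψ₀ '' B₀.timeSlab τ₀) ∧ (∃ C₁ C₂ : ℝ, ∀ i (x : U i) (y : U₀), τ₀ < (B i).time x.1 → Ψ i x = Ψ₀ y → ‖E4.spatial y.1 - ξ i (y.1 0)‖ ≤ C₂ * (B i).radius x.1 + C₁) ∧ (∃ C_W : ℝ, ∀ᶠ τ in atTop, ∀ x : U₀, x.1 0 = τ → let w := 1 + ⨅ i, ‖E4.spatial x.1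 - ξ i τ‖; w ^ (9 / 10 : ℝ) * ‖h x.1‖ ≤ C_W ∧ ∀ m : ℕ, 1 ≤ m → m ≤ 2 → w * ‖iteratedFDeriv ℝ m h x.1‖ ≤ C_W) ∧ (∃ C_E : ℝ, ∀ᶠ τ in atTop, ∫⁻ y in {y : E3 | E4.ofTimeSpace τ y ∈ U₀}, ‖iteratedFDeriv ℝ 1 h (E4.ofTimeSpace τ y)‖ₑ ^ 2 ≤ ENNReal.ofReal C_E) ∧ ∃ R : Fin N → ℝ → ℝ, (∀ i, Tendsto (fun τ ↦ S.truncDeviationCk (B i) (Ψ i) 2 (R i τ) τ) atTop (𝓝 0)) ∧ ∀ τ₁ > τ₀, O \ (Ψ₀ '' B₀.lateRegion τ₁ ∪ ⋃ i, Ψ i '' {x | τ₁ < (B i).time x.1 ∧ (B i).radius x.1 ≤ R i ((B i).time x.1)}) ⊆ J (Ψ₀ '' B₀.timeSlab τ₁ ∪ ⋃ i, Ψ i '' (B i).truncTimeSlab (R i τ₁) τ₁)) → ∀ (Mc ac : Fin N → ℝ), (∀ i, Tendsto (M i) atTop (𝓝 (Mc i))) → (∀ i, Tendsto (a i) atTop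 (𝓝 (ac i))) → ∀ (τ₁ : ℝ) (Φ : Fin N → E4 → E4), τ₀ ≤ τ₁ → (let p := fun i ↦ poincareInv (motion i).1 (motion i).2; let B : Fin N → ModelBackground := fun i ↦ ⟨U i, fun x ↦ boostedKerrBilin (motion i).1 (motion i).2 (M i (p i x 0)) (a i (p i x 0)) x, fun x ↦ p i x 0, fun x ↦ Kerr.radius (a i (p i x 0)) (p i x)⟩; let F : Fin N → Set E4 := fun i ↦ ↑(boostedKerrExterior (motion i).1 (motion i).2 (Mc i) (ac i)); ∀ i, ContDiff ℝ (⊤ : ℕ∞) (Φ i) ∧ (∀ x, p i (Φ i x) 0 = p i x 0) ∧ (∀ x, τ₁ < p i x 0 → Kerr.rPlus (Mc i) (ac i) + 1 ≤ Kerr.radius (ac i) (p i x) → Φ i x = x) ∧ Set.MapsTo (Φ i) (F i) (U i : Set E4) ∧ IsOpenEmbedding ((F i ∩ {x | τ₁ < p i x 0}).restrict (Φ i)) ∧ (∀ R : ℝ, Tendsto (fun τ ↦ supCkENorm (F i ∩ {x | p i x 0 = τ ∧ Kerr.radius (ac i) (p i x) ≤ R}) 3 (fun x ↦ Φ i x -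 x)) atTop (𝓝 0)) ∧ Ψ i '' {y : U i | (y : E4) ∈ Φ i '' (F i ∩ {x | τ₁ < p i x 0})} = O ∩ Ψ i '' (B i).lateRegion τ₁) → ∃ (τ₂ : ℝ) (Ψ' : ∀ i, ↥(boostedKerrBackground (motion i).1 (motion i).2 (Mc i) (ac i)).domain → 𝒟.carrier), (let S := 𝒟.toSpacetime; let 𝒞 := 𝒟.toCauchyDevelopment; let J := 𝒟.metric.causalPast 𝒟.timeOrientation; let L := fun i ↦ ((motion i).1 : E4 ≃L[ℝ] E4); let p := fun i ↦ poincareInv (motion i).1 (motion i).2; let e := fun i ↦ L i (E4.basisVector 0); let Bf : Fin N → ModelBackground := fun i ↦ boostedKerrBackground (motion i).1 (motion i).2 (Mc i) (ac i); let B₀ := Minkowski.backgroundOn U₀; let O' := exteriorOf 𝒞 (Ψ₀ '' B₀.lateRegion τ₂ ∪ ⋃ i, Ψ' i '' (Bf i).lateRegion τ₂); (0 < m₀ ∧ 0 ≤ χ ∧ χ < 1 ∧ ∀ i, m₀ ≤ Mc i ∧ |ac i| ≤ χ * Mc i) ∧ (∀ i, 0 < e i 0) ∧ (∀ i, S.IsLateChart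 (Bf i) O' τ₂ (Ψ' i)) ∧ (∀ i (R : ℝ), Tendsto (S.truncDeviationCk (Bf i) (Ψ' i) 2 R) atTop (𝓝 0)) ∧ (∀ R : ℝ, ∃ τ₃, Pairwise (Disjoint on fun i ↦ Ψ' i '' (Bf i).truncLateRegion τ₃ R)) ∧ (∀ i, Tendsto (fun t ↦ ρ i t / t) atTop (𝓝 0)) ∧ {x : E4 | τ₂ < x 0 ∧ ∀ i, ρ i (x 0) < Kerr.radius (ac i) (p i x)} ⊆ ↑U₀ ∧ S.IsLateChart B₀ O' τ₂ Ψ₀ ∧ Tendsto (S.deviationCk B₀ Ψ₀ 2) atTop (𝓝 0) ∧ O' \ ((⋃ i, Ψ' i '' (Bf i).lateRegion τ₂) ∪ Ψ₀ '' B₀.lateRegion τ₂) ⊆ J ((⋃ i, Ψ' i '' (Bf i).timeSlab τ₂) ∪ Ψ₀ '' B₀.timeSlab τ₂) ∧ RaysStayInClosure 𝒞 (exteriorOf 𝒞 (Ψ₀ '' B₀.lateRegion τ₂)) ∧ (∀ i (ϱ : ℝ), ∀ᶠ τ in atTop, ∀ x ∈ (Bf i).truncTimeSlab ϱ τ, 𝒟.timeOrientation.IsFutureDirected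 (mfderiv 𝓘(ℝ, E4) (𝓡 4) (Ψ' i) x (L i (Kerr.timeVector (Mc i) (ac i) (p i x.1))))) ∧ (∀ᶠ τ in atTop, ∀ x ∈ B₀.timeSlab τ, 𝒟.timeOrientation.IsFutureDirected (mfderiv 𝓘(ℝ, E4) (𝓡 4) Ψ₀ x (E4.basisVector 0))) ∧ ∃ R : Fin N → ℝ → ℝ, (∀ i, Tendsto (fun τ ↦ S.truncDeviationCk (Bf i) (Ψ' i) 2 (R i τ) τ) atTop (𝓝 0)) ∧ ∀ τ' > τ₂, O' \ (Ψ₀ '' B₀.lateRegion τ' ∪ ⋃ i, Ψ' i '' {x | τ' < (Bf i).time x.1 ∧ (Bf i).radius x.1 ≤ R i ((Bf i).time x.1)}) ⊆ J (Ψ₀ '' B₀.timeSlab τ' ∪ ⋃ i, Ψ' i '' (Bf i).truncTimeSlab (R i τ') τ'))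

/-- Statement of `stub_packageDecomposition` (P): a frozen anchored era ⇒ the conclusion of `Reanchoring` (verbatim). -/
def Sig.stub_packageDecomposition : Prop :=
  open Literature.Geometry.Lorentzian Summit.FinalStateConjecture in ∀ (X : Type) [TopologicalSpace X] [ChartedSpace E3 X] [IsManifold (𝓡 3) (⊤ : ℕ∞) X] [T2Space X] [SecondCountableTopology X] [ConnectedSpace X], ∀ D ∈ admissibleVacuumData X, ∀ 𝒟 : VacuumCauchyDevelopment D, 𝒟.IsMaximal → HasCompleteNullInfinity 𝒟.toCauchyDevelopment → ∀ (N : ℕ) (m₀ χ τ₂ : ℝ) (Mc ac : Fin N → ℝ) (motion : Fin N → lorentzGroup × E4) (Ψ' : ∀ i, ↥(boostedKerrBackground (motion i).1 (motion i).2 (Mc i) (ac i)).domain → 𝒟.carrier) (ρ : Fin N → ℝ → ℝ) (U₀ : Opens E4) (Ψ₀ : U₀ → 𝒟.carrier), (let S := 𝒟.toSpacetime; let 𝒞 := 𝒟.toCauchyDevelopment; let J := 𝒟.metric.causalPast 𝒟.timeOrientation; let L := fun i ↦ ((motion i).1 : E4 ≃L[ℝ] E4); let p := fun i ↦ poincareInv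 (motion i).1 (motion i).2; let e := fun i ↦ L i (E4.basisVector 0); let Bf : Fin N → ModelBackground := fun i ↦ boostedKerrBackground (motion i).1 (motion i).2 (Mc i) (ac i); let B₀ := Minkowski.backgroundOn U₀; let O' := exteriorOf 𝒞 (Ψ₀ '' B₀.lateRegion τ₂ ∪ ⋃ i, Ψ' i '' (Bf i).lateRegion τ₂); (0 < m₀ ∧ 0 ≤ χ ∧ χ < 1 ∧ ∀ i, m₀ ≤ Mc i ∧ |ac i| ≤ χ * Mc i) ∧ (∀ i, 0 < e i 0) ∧ (∀ i, S.IsLateChart (Bf i) O' τ₂ (Ψ' i)) ∧ (∀ i (R : ℝ), Tendsto (S.truncDeviationCk (Bf i) (Ψ' i) 2 R) atTop (𝓝 0)) ∧ (∀ R : ℝ, ∃ τ₃, Pairwise (Disjoint on fun i ↦ Ψ' i '' (Bf i).truncLateRegion τ₃ R)) ∧ (∀ i, Tendsto (fun t ↦ ρ i t / t) atTop (𝓝 0)) ∧ {x : E4 | τ₂ < x 0 ∧ ∀ i, ρ i (x 0) < Kerr.radius (ac i) (p i x)} ⊆ ↑U₀ ∧ S.IsLateChart B₀ O' τ₂ Ψ₀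 ∧ Tendsto (S.deviationCk B₀ Ψ₀ 2) atTop (𝓝 0) ∧ O' \ ((⋃ i, Ψ' i '' (Bf i).lateRegion τ₂) ∪ Ψ₀ '' B₀.lateRegion τ₂) ⊆ J ((⋃ i, Ψ' i '' (Bf i).timeSlab τ₂) ∪ Ψ₀ '' B₀.timeSlab τ₂) ∧ RaysStayInClosure 𝒞 (exteriorOf 𝒞 (Ψ₀ '' B₀.lateRegion τ₂)) ∧ (∀ i (ϱ : ℝ), ∀ᶠ τ in atTop, ∀ x ∈ (Bf i).truncTimeSlab ϱ τ, 𝒟.timeOrientation.IsFutureDirected (mfderiv 𝓘(ℝ, E4) (𝓡 4) (Ψ' i) x (L i (Kerr.timeVector (Mc i) (ac i) (p i x.1))))) ∧ (∀ᶠ τ in atTop, ∀ x ∈ B₀.timeSlab τ, 𝒟.timeOrientation.IsFutureDirected (mfderiv 𝓘(ℝ, E4) (𝓡 4) Ψ₀ x (E4.basisVector 0))) ∧ ∃ R : Fin N → ℝ → ℝ, (∀ i, Tendsto (fun τ ↦ S.truncDeviationCk (Bf i) (Ψ' i) 2 (R i τ) τ) atTop (𝓝 0)) ∧ ∀ τ'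 > τ₂, O' \ (Ψ₀ '' B₀.lateRegion τ' ∪ ⋃ i, Ψ' i '' {x | τ' < (Bf i).time x.1 ∧ (Bf i).radius x.1 ≤ R i ((Bf i).time x.1)}) ⊆ J (Ψ₀ '' B₀.timeSlab τ' ∪ ⋃ i, Ψ' i '' (Bf i).truncTimeSlab (R i τ') τ')) → ∃ (O' : Set 𝒟.carrier) (d : FinalStateDecomposition 𝒟.toSpacetime O' 2), (∀ i, Kerr.IsSubextremal (d.mass i) (d.spin i)) ∧ O' = exteriorOf 𝒟.toCauchyDevelopment d.charted ∧ RaysStayInClosure 𝒟.toCauchyDevelopment O' ∧ HasExhaustiveCharts d ∧ IsFutureOriented d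

/-! ## Registered stubs (`sorry` only here; signatures def-free and self-contained) -/

/-- **H — HORIZON STRAIGHTENING** (load-bearing; XL).  Under the route's `Q′` block (verbatim the hypothesis of `Reanchoring`)
and convergence of the labels `M i → Mc i`, `a i → ac i`: there are `τ₁ ≥ τ₀` and maps `Φ i : E4 → E4` with, writing
`p i = Λᵢ⁻¹(· − cᵢ)`, `B i` the drifting collar background and `F i = boostedKerrExterior Λᵢ cᵢ (Mc i) (ac i)` the frozen exterior:
(1) `Φ i` smooth; (2) hole-time preserving, `(p i (Φ i x))⁰ = (p i x)⁰`; (3) the identity at late times outside the unit shell,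
`r_{ac i}(p i x) ≥ r₊(Mc i, ac i) + 1 ⇒ Φ i x = x`; (4) `Φ i` maps `F i` into the collar `U i` (all times, so that `Ψ i ∘ Φ i` is a
smooth map of the whole frozen exterior); (5) `Φ i` restricted to the late frozen exterior `F i ∩ {t*ᵢ > τ₁}` is an open embedding;
(6) `Φ i − id → 0` in `C³` on the truncated frozen slabs `{t*ᵢ = τ, r∞ ≤ R}` for every `R`; (7) ANCHORING:
`Ψ i '' (Φ i '' (F i ∩ {t*ᵢ > τ₁})) = O ∩ Ψ i '' {t*ᵢ > τ₁}`.  Intended witness: the radial graph map of the frozen exterior onto the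
part of the collar outside `𝓗⁺ = ∂O ∩ (collar image) = {r = r_H(t*, ω)}`, interpolated to the identity on `r∞ ≥ r₊∞ + 1` and to a
radial push-out at early times.  Why plausibly true: (E) + `ext ⊆ O` force `r_H ≤ r₊(M(t), a(t))` and `O ∩ (BH ∪ 𝓗⁺) = ∅` (a causal
curve below a near-Kerr horizon leaves the collar inward within hole time `≲ κ⁻¹ log`), the sliver `{r_H < r ≤ r₊(t)}` is in `O`
(outgoing directions reach `ext`, achronality of `Σ` gives `J⁺(Σ)`), and the late horizon is the stable manifold of the generator flow of
a metric `Cᵏ`-asymptotic (every `k`) to sub-extremal Kerr, `κ(Mc, ac) > 0` (`|ac| ≤ χ Mc < Mc`), hence a smooth graph → `r₊∞` in every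
`Cᵏ`.  Why it might fail: non-autonomous stable-manifold regularity with uniform neighbourhoods; the exact set identity (7) needs the
near-horizon causal bookkeeping at late times; none of it is in Lean.  Leans on: `Q′` clauses (4)–(6), (11), (13), (15), (16);
`Kerr.rPlus`, `Kerr.radius`, `boostedKerrExterior`, `supCkENorm`.  Sources: HawkingEllis1973 (§9.2–9.3), arXiv:gr-qc/0001003
(Chruściel–Delay–Galloway–Howard, horizon regularity), arXiv:0811.0354 (§5.1, red-shift), arXiv:2104.08222 (§1), AshtekarKrishnan2004,
Hirsch–Pugh–Shub 1977 (stable manifolds).  Size: XL. -/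
theorem stub_horizonStraightening : open Literature.Geometry.Lorentzian Summit.FinalStateConjecture in ∀ (X : Type) [TopologicalSpace X] [ChartedSpace E3 X] [IsManifold (𝓡 3) (⊤ : ℕ∞) X] [T2Space X] [SecondCountableTopology X] [ConnectedSpace X], ∀ D ∈ admissibleVacuumData X, ∀ 𝒟 : VacuumCauchyDevelopment D, 𝒟.IsMaximal → HasCompleteNullInfinity 𝒟.toCauchyDevelopment → ∀ (N : ℕ) (m₀ χ τ₀ δ₀ : ℝ) (M a : Fin N → ℝ → ℝ) (motion : Fin N → lorentzGroup × E4) (U : Fin N → Opens E4) (Ψ : ∀ i, U i → 𝒟.carrier) (ρ : Fin N → ℝ → ℝ) (U₀ : Opens E4) (Ψ₀ : U₀ → 𝒟.carrier) (O : Set 𝒟.carrier), (let S := 𝒟.toSpacetime; let 𝒞 := 𝒟.toCauchyDevelopment; let J := 𝒟.metric.causalPast 𝒟.timeOrientation; let L := fun i ↦ ((motion i).1 : E4 ≃L[ℝ] E4); let p := fun i ↦ poincareInv (motion i).1 (motion i).2; let e := fun i ↦ L i (E4.basisVector 0); let B : Fin N → ModelBackground := fun i ↦ ⟨U i, fun x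 ↦ boostedKerrBilin (motion i).1 (motion i).2 (M i (p i x 0)) (a i (p i x 0)) x, fun x ↦ p i x 0, fun x ↦ Kerr.radius (a i (p i x 0)) (p i x)⟩; let ξ := fun i (t : ℝ) ↦ E4.spatial (((t - (motion i).2 0) / e i 0) • e i + (motion i).2); let B₀ := Minkowski.backgroundOn U₀; let h := S.deviationExtend B₀ Ψ₀; let ext := fun i ↦ (B i).lateRegion τ₀ ∩ {x | Kerr.rPlus (M i (p i x.1 0)) (a i (p i x.1 0)) < (B i).radius x.1}; (0 < m₀ ∧ 0 ≤ χ ∧ χ < 1 ∧ 0 < δ₀ ∧ 2 * δ₀ < m₀) ∧ (∀ i, ContDiff ℝ (⊤ : ℕ∞) (M i) ∧ ContDiff ℝ (⊤ : ℕ∞) (a i) ∧ (∀ t, m₀ ≤ M i t ∧ M i t ≤ m₀⁻¹ ∧ |a i t| ≤ χ * M i t) ∧ ∀ n : ℕ, 1 ≤ n → Tendsto (iteratedDeriv n (M i)) atTop (𝓝 0) ∧ Tendsto (iteratedDeriv n (a i)) atTop (𝓝 0)) ∧ (∀ i, 0 < e i 0) ∧ Function.Injective e ∧ (∀ i, (U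 i : Set E4) = p i ⁻¹' {y : E4 | Kerr.rPlus (M i (y 0)) (a i (y 0)) - δ₀ < Kerr.radius (a i (y 0)) y}) ∧ (∀ i, S.IsLateChart (B i) Set.univ τ₀ (Ψ i) ∧ Ψ i '' ext i ⊆ O) ∧ (∀ i (k : ℕ) (R : ℝ), Tendsto (S.truncDeviationCk (B i) (Ψ i) k R) atTop (𝓝 0)) ∧ (∀ R : ℝ, ∃ τ₁, Pairwise (Disjoint on fun i ↦ Ψ i '' (B i).truncLateRegion τ₁ R)) ∧ (∀ i, Tendsto (fun t ↦ ρ i t / t) atTop (𝓝 0)) ∧ {x : E4 | τ₀ < x 0 ∧ ∀ i, ρ i (x 0) < E4.spatialNorm (p i x)} ⊆ ↑U₀ ∧ S.IsLateChart B₀ O τ₀ Ψ₀ ∧ Tendsto (S.deviationCk B₀ Ψ₀ 2) atTop (𝓝 0) ∧ O = exteriorOf 𝒞 (Ψ₀ '' B₀.lateRegion τ₀ ∪ ⋃ i, Ψ i '' ext i) ∧ (∀ τ₁ ≥ τ₀, RaysStayInClosure 𝒞 (exteriorOf 𝒞 (Ψ₀ '' B₀.lateRegion τ₁))) ∧ (∀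 i (ϱ : ℝ), ∀ᶠ τ in atTop, ∀ x ∈ (B i).truncTimeSlab ϱ τ, 𝒟.timeOrientation.IsFutureDirected (mfderiv 𝓘(ℝ, E4) (𝓡 4) (Ψ i) x (L i (Kerr.timeVector (M i (p i x.1 0)) (a i (p i x.1 0)) (p i x.1))))) ∧ (∀ᶠ τ in atTop, ∀ x ∈ B₀.timeSlab τ, 𝒟.timeOrientation.IsFutureDirected (mfderiv 𝓘(ℝ, E4) (𝓡 4) Ψ₀ x (E4.basisVector 0))) ∧ O \ ((⋃ i, Ψ i '' (B i).lateRegion τ₀) ∪ Ψ₀ '' B₀.lateRegion τ₀) ⊆ J ((⋃ i, Ψ i '' (B i).timeSlab τ₀) ∪ Ψ₀ '' B₀.timeSlab τ₀) ∧ (∃ C₁ C₂ : ℝ, ∀ i (x : U i) (y : U₀), τ₀ < (B i).time x.1 → Ψ i x = Ψ₀ y → ‖E4.spatial y.1 - ξ i (y.1 0)‖ ≤ C₂ * (B i).radius x.1 + C₁) ∧ (∃ C_W : ℝ, ∀ᶠ τ in atTop, ∀ x : U₀, x.1 0 = τ → let w := 1 + ⨅ i, ‖E4.spatial x.1 - ξ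 i τ‖; w ^ (9 / 10 : ℝ) * ‖h x.1‖ ≤ C_W ∧ ∀ m : ℕ, 1 ≤ m → m ≤ 2 → w * ‖iteratedFDeriv ℝ m h x.1‖ ≤ C_W) ∧ (∃ C_E : ℝ, ∀ᶠ τ in atTop, ∫⁻ y in {y : E3 | E4.ofTimeSpace τ y ∈ U₀}, ‖iteratedFDeriv ℝ 1 h (E4.ofTimeSpace τ y)‖ₑ ^ 2 ≤ ENNReal.ofReal C_E) ∧ ∃ R : Fin N → ℝ → ℝ, (∀ i, Tendsto (fun τ ↦ S.truncDeviationCk (B i) (Ψ i) 2 (R i τ) τ) atTop (𝓝 0)) ∧ ∀ τ₁ > τ₀, O \ (Ψ₀ '' B₀.lateRegion τ₁ ∪ ⋃ i, Ψ i '' {x | τ₁ < (B i).time x.1 ∧ (B i).radius x.1 ≤ R i ((B i).time x.1)}) ⊆ J (Ψ₀ '' B₀.timeSlab τ₁ ∪ ⋃ i, Ψ i '' (B i).truncTimeSlab (R i τ₁) τ₁)) → ∀ (Mc ac : Fin N → ℝ), (∀ i, Tendsto (M i) atTop (𝓝 (Mc i))) → (∀ i, Tendsto (a i) atTop (𝓝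 (ac i))) → ∃ (τ₁ : ℝ) (Φ : Fin N → E4 → E4), τ₀ ≤ τ₁ ∧ (let p := fun i ↦ poincareInv (motion i).1 (motion i).2; let B : Fin N → ModelBackground := fun i ↦ ⟨U i, fun x ↦ boostedKerrBilin (motion i).1 (motion i).2 (M i (p i x 0)) (a i (p i x 0)) x, fun x ↦ p i x 0, fun x ↦ Kerr.radius (a i (p i x 0)) (p i x)⟩; let F : Fin N → Set E4 := fun i ↦ ↑(boostedKerrExterior (motion i).1 (motion i).2 (Mc i) (ac i)); ∀ i, ContDiff ℝ (⊤ : ℕ∞) (Φ i) ∧ (∀ x, p i (Φ i x) 0 = p i x 0) ∧ (∀ x, τ₁ < p i x 0 → Kerr.rPlus (Mc i) (ac i) + 1 ≤ Kerr.radius (ac i) (p i x) → Φ i x = x) ∧ Set.MapsTo (Φ i) (F i) (U i : Set E4) ∧ IsOpenEmbedding ((F i ∩ {x | τ₁ < p i x 0}).restrict (Φ i)) ∧ (∀ R : ℝ, Tendsto (fun τ ↦ supCkENorm (F i ∩ {x | p i x 0 = τ ∧ Kerr.radius (ac i) (p i x) ≤ R}) 3 (fun x ↦ Φ i x - x)) atTop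 (𝓝 0)) ∧ Ψ i '' {y : U i | (y : E4) ∈ Φ i '' (F i ∩ {x | τ₁ < p i x 0})} = O ∩ Ψ i '' (B i).lateRegion τ₁) := by
  sorry

/-- **T — ADIABATIC-TO-FROZEN TRANSPORT** (L).  Under `Q′`, the label limits `(Mc, ac)` and a straightening package `(τ₁, Φ)`
exactly as concluded by H, there are a late time `τ₂` and charts `Ψ′ i` on the frozen exteriors `(boostedKerrBackground Λᵢ cᵢ (Mc i) (ac i)).domain`
(intended: `Ψ′ i = Ψ i ∘ Φ i`) forming a FROZEN ANCHORED ERA for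
`O′ := exteriorOf 𝒟 (Ψ₀ '' {x⁰ > τ₂} ∪ ⋃ᵢ Ψ′ i '' {t*ᵢ > τ₂})`: the limits obey the box (`m₀ ≤ Mc i`, `|ac i| ≤ χ Mc i`, `0 < m₀`,
`χ < 1`); motions orthochronous; `Ψ′ i` and `Ψ₀` are late charts into `O′` after `τ₂`; truncated `C²` convergence of `Ψ′ i^* g` to
the FROZEN boosted Kerr–Schild form for every radius; separation of the truncated world-tubes; `ρᵢ(t)/t → 0`; the late flat
half-space minus the tubes `{r_{ac i}(Λᵢ⁻¹(x − cᵢ)) ≤ ρᵢ(x⁰)}` lies in `U₀`; flat `C²` convergence; the covering clause at `τ₂`;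
`RaysStayInClosure 𝒟 (exteriorOf 𝒟 (Ψ₀ '' {x⁰ > τ₂}))`; future orientation of `dΨ′ i (Λᵢ V_{Mc i, ac i})` on late truncated slabs and of
`dΨ₀ ∂₀` on late flat slabs; and `Q′`-SHAPED EXHAUSTIVENESS of `O′` in the new charts (some radii `R`, honesty not claimed).  Why
plausibly true: `(Ψ∘Φ)^*g − g_{Mc,ac} = Φ^*(Ψ^*g − g_{M(t),a(t)}) + (Φ^*g_t − g_t) + (g_t − g_{Mc,ac})` with `Φ → id` in `C³`, `Cᵏ` collar
convergence on the slab of radius `R + 1`, joint smoothness of the Kerr–Schild field in `(M, a, x)` off the ring and label convergence;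
open embeddings compose and late images are open, so `W ⊆ I⁻(W)` puts them inside `O′ ⊆ O`; `Kerr.radius a y ≤ ‖y̲‖` converts the excision
clause; separation and orientation transfer by `C⁰`/`C¹` closeness on bounded radii (two nearby `g`-timelike vectors lie in one nappe);
rays = `Q′`(16) at `τ₂ ≥ τ₀`; exhaustiveness transports from (E) through the anchoring H(7): flat-certified and collar-certified
points of `O′ ⊆ O` are certified in the new charts with radii `max(R, 0) + r₊∞ + 2` (injectivity of `Ψ i` on the late collar, radius
comparison, `Φ = id` outside the unit shell), and a point certified only through a collar slab point OUTSIDE `O` (on/behind `𝓗⁺`) is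
re-certified through the exterior near-horizon slab by flowing along the Gaussian-null field of the late horizon.  Why it might fail:
that last re-certification needs a UNIFORM Gaussian-null collar of the late horizon and control of causal curves that enter the black
hole early; all of `Q′`'s thresholds are "eventually, per radius", so every step must be run at a fixed bounded radius; the covering
clause at `τ₂` is taken from (E) at `τ₂` with `τ₂ − 1` as base.  Leans on: H(1)–(7); `Q′` (1)–(3), (5)–(10), (12), (14)–(17); `Spacetime.IsLateChart`,
`truncDeviationCk`, `Kerr.timeVector`, `boostedKerrBackground`.  Sources: arXiv:2104.08222 (§1), KlainermanSzeftel2023 (Thm. 1.1),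
arXiv:0811.0354 (§5.1), HawkingEllis1973 (§6.4, §9.2), arXiv:gr-qc/0508107, DafermosLuk2017 (Conj. 1).  Size: L. -/
theorem stub_frozenTransport : open Literature.Geometry.Lorentzian Summit.FinalStateConjecture in ∀ (X : Type) [TopologicalSpace X] [ChartedSpace E3 X] [IsManifold (𝓡 3) (⊤ : ℕ∞) X] [T2Space X] [SecondCountableTopology X] [ConnectedSpace X], ∀ D ∈ admissibleVacuumData X, ∀ 𝒟 : VacuumCauchyDevelopment D, 𝒟.IsMaximal → HasCompleteNullInfinity 𝒟.toCauchyDevelopment → ∀ (N : ℕ) (m₀ χ τ₀ δ₀ : ℝ) (M a : Fin N → ℝ → ℝ) (motion : Fin N → lorentzGroup × E4) (U : Fin N → Opens E4) (Ψ : ∀ i, U i → 𝒟.carrier) (ρ : Fin N → ℝ → ℝ) (U₀ : Opens E4) (Ψ₀ : U₀ → 𝒟.carrier) (O : Set 𝒟.carrier), (let S := 𝒟.toSpacetime; let 𝒞 := 𝒟.toCauchyDevelopment; let J := 𝒟.metric.causalPast 𝒟.timeOrientation; let L := fun i ↦ ((motion i).1 : E4 ≃L[ℝ] E4); let p := fun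 i ↦ poincareInv (motion i).1 (motion i).2; let e := fun i ↦ L i (E4.basisVector 0); let B : Fin N → ModelBackground := fun i ↦ ⟨U i, fun x ↦ boostedKerrBilin (motion i).1 (motion i).2 (M i (p i x 0)) (a i (p i x 0)) x, fun x ↦ p i x 0, fun x ↦ Kerr.radius (a i (p i x 0)) (p i x)⟩; let ξ := fun i (t : ℝ) ↦ E4.spatial (((t - (motion i).2 0) / e i 0) • e i + (motion i).2); let B₀ := Minkowski.backgroundOn U₀; let h := S.deviationExtend B₀ Ψ₀; let ext := fun i ↦ (B i).lateRegion τ₀ ∩ {x | Kerr.rPlus (M i (p i x.1 0)) (a i (p i x.1 0)) < (B i).radius x.1}; (0 < m₀ ∧ 0 ≤ χ ∧ χ < 1 ∧ 0 < δ₀ ∧ 2 * δ₀ < m₀) ∧ (∀ i, ContDiff ℝ (⊤ : ℕ∞) (M i) ∧ ContDiff ℝ (⊤ : ℕ∞) (a i) ∧ (∀ t, m₀ ≤ M i t ∧ M i t ≤ m₀⁻¹ ∧ |a i t| ≤ χ * M i t) ∧ ∀ n : ℕ, 1 ≤ n → Tendsto (iteratedDeriv n (M i)) atTop (𝓝 0)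 ∧ Tendsto (iteratedDeriv n (a i)) atTop (𝓝 0)) ∧ (∀ i, 0 < e i 0) ∧ Function.Injective e ∧ (∀ i, (U i : Set E4) = p i ⁻¹' {y : E4 | Kerr.rPlus (M i (y 0)) (a i (y 0)) - δ₀ < Kerr.radius (a i (y 0)) y}) ∧ (∀ i, S.IsLateChart (B i) Set.univ τ₀ (Ψ i) ∧ Ψ i '' ext i ⊆ O) ∧ (∀ i (k : ℕ) (R : ℝ), Tendsto (S.truncDeviationCk (B i) (Ψ i) k R) atTop (𝓝 0)) ∧ (∀ R : ℝ, ∃ τ₁, Pairwise (Disjoint on fun i ↦ Ψ i '' (B i).truncLateRegion τ₁ R)) ∧ (∀ i, Tendsto (fun t ↦ ρ i t / t) atTop (𝓝 0)) ∧ {x : E4 | τ₀ < x 0 ∧ ∀ i, ρ i (x 0) < E4.spatialNorm (p i x)} ⊆ ↑U₀ ∧ S.IsLateChart B₀ O τ₀ Ψ₀ ∧ Tendsto (S.deviationCk B₀ Ψ₀ 2) atTop (𝓝 0) ∧ O = exteriorOf 𝒞 (Ψ₀ '' B₀.lateRegion τ₀ ∪ ⋃ i, Ψ i '' ext i) ∧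 (∀ τ₁ ≥ τ₀, RaysStayInClosure 𝒞 (exteriorOf 𝒞 (Ψ₀ '' B₀.lateRegion τ₁))) ∧ (∀ i (ϱ : ℝ), ∀ᶠ τ in atTop, ∀ x ∈ (B i).truncTimeSlab ϱ τ, 𝒟.timeOrientation.IsFutureDirected (mfderiv 𝓘(ℝ, E4) (𝓡 4) (Ψ i) x (L i (Kerr.timeVector (M i (p i x.1 0)) (a i (p i x.1 0)) (p i x.1))))) ∧ (∀ᶠ τ in atTop, ∀ x ∈ B₀.timeSlab τ, 𝒟.timeOrientation.IsFutureDirected (mfderiv 𝓘(ℝ, E4) (𝓡 4) Ψ₀ x (E4.basisVector 0))) ∧ O \ ((⋃ i, Ψ i '' (B i).lateRegion τ₀) ∪ Ψ₀ '' B₀.lateRegion τ₀) ⊆ J ((⋃ i, Ψ i '' (B i).timeSlab τ₀) ∪ Ψ₀ '' B₀.timeSlab τ₀) ∧ (∃ C₁ C₂ : ℝ, ∀ i (x : U i) (y : U₀), τ₀ < (B i).time x.1 → Ψ i x = Ψ₀ y → ‖E4.spatial y.1 - ξ i (y.1 0)‖ ≤ C₂ * (B i).radius x.1 + C₁) ∧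 (∃ C_W : ℝ, ∀ᶠ τ in atTop, ∀ x : U₀, x.1 0 = τ → let w := 1 + ⨅ i, ‖E4.spatial x.1 - ξ i τ‖; w ^ (9 / 10 : ℝ) * ‖h x.1‖ ≤ C_W ∧ ∀ m : ℕ, 1 ≤ m → m ≤ 2 → w * ‖iteratedFDeriv ℝ m h x.1‖ ≤ C_W) ∧ (∃ C_E : ℝ, ∀ᶠ τ in atTop, ∫⁻ y in {y : E3 | E4.ofTimeSpace τ y ∈ U₀}, ‖iteratedFDeriv ℝ 1 h (E4.ofTimeSpace τ y)‖ₑ ^ 2 ≤ ENNReal.ofReal C_E) ∧ ∃ R : Fin N → ℝ → ℝ, (∀ i, Tendsto (fun τ ↦ S.truncDeviationCk (B i) (Ψ i) 2 (R i τ) τ) atTop (𝓝 0)) ∧ ∀ τ₁ > τ₀, O \ (Ψ₀ '' B₀.lateRegion τ₁ ∪ ⋃ i, Ψ i '' {x | τ₁ < (B i).time x.1 ∧ (B i).radius x.1 ≤ R i ((B i).time x.1)}) ⊆ J (Ψ₀ '' B₀.timeSlab τ₁ ∪ ⋃ i, Ψ i '' (B i).truncTimeSlab (R i τ₁) τ₁))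 → ∀ (Mc ac : Fin N → ℝ), (∀ i, Tendsto (M i) atTop (𝓝 (Mc i))) → (∀ i, Tendsto (a i) atTop (𝓝 (ac i))) → ∀ (τ₁ : ℝ) (Φ : Fin N → E4 → E4), τ₀ ≤ τ₁ → (let p := fun i ↦ poincareInv (motion i).1 (motion i).2; let B : Fin N → ModelBackground := fun i ↦ ⟨U i, fun x ↦ boostedKerrBilin (motion i).1 (motion i).2 (M i (p i x 0)) (a i (p i x 0)) x, fun x ↦ p i x 0, fun x ↦ Kerr.radius (a i (p i x 0)) (p i x)⟩; let F : Fin N → Set E4 := fun i ↦ ↑(boostedKerrExterior (motion i).1 (motion i).2 (Mc i) (ac i)); ∀ i, ContDiff ℝ (⊤ : ℕ∞) (Φ i) ∧ (∀ x, p i (Φ i x) 0 = p i x 0) ∧ (∀ x, τ₁ < p i x 0 → Kerr.rPlus (Mc i) (ac i) + 1 ≤ Kerr.radius (ac i) (p i x) → Φ i x = x) ∧ Set.MapsTo (Φ i) (F i) (U i : Set E4) ∧ IsOpenEmbedding ((F i ∩ {x | τ₁ < p i x 0}).restrict (Φ i)) ∧ (∀ R : ℝ, Tendsto (fun τ ↦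 supCkENorm (F i ∩ {x | p i x 0 = τ ∧ Kerr.radius (ac i) (p i x) ≤ R}) 3 (fun x ↦ Φ i x - x)) atTop (𝓝 0)) ∧ Ψ i '' {y : U i | (y : E4) ∈ Φ i '' (F i ∩ {x | τ₁ < p i x 0})} = O ∩ Ψ i '' (B i).lateRegion τ₁) → ∃ (τ₂ : ℝ) (Ψ' : ∀ i, ↥(boostedKerrBackground (motion i).1 (motion i).2 (Mc i) (ac i)).domain → 𝒟.carrier), (let S := 𝒟.toSpacetime; let 𝒞 := 𝒟.toCauchyDevelopment; let J := 𝒟.metric.causalPast 𝒟.timeOrientation; let L := fun i ↦ ((motion i).1 : E4 ≃L[ℝ] E4); let p := fun i ↦ poincareInv (motion i).1 (motion i).2; let e := fun i ↦ L i (E4.basisVector 0); let Bf : Fin N → ModelBackground := fun i ↦ boostedKerrBackground (motion i).1 (motion i).2 (Mc i) (ac i); let B₀ := Minkowski.backgroundOn U₀; let O' := exteriorOf 𝒞 (Ψ₀ '' B₀.lateRegion τ₂ ∪ ⋃ i, Ψ' i '' (Bf i).lateRegion τ₂); (0 < m₀ ∧ 0 ≤ χ ∧ χ < 1 ∧ ∀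 i, m₀ ≤ Mc i ∧ |ac i| ≤ χ * Mc i) ∧ (∀ i, 0 < e i 0) ∧ (∀ i, S.IsLateChart (Bf i) O' τ₂ (Ψ' i)) ∧ (∀ i (R : ℝ), Tendsto (S.truncDeviationCk (Bf i) (Ψ' i) 2 R) atTop (𝓝 0)) ∧ (∀ R : ℝ, ∃ τ₃, Pairwise (Disjoint on fun i ↦ Ψ' i '' (Bf i).truncLateRegion τ₃ R)) ∧ (∀ i, Tendsto (fun t ↦ ρ i t / t) atTop (𝓝 0)) ∧ {x : E4 | τ₂ < x 0 ∧ ∀ i, ρ i (x 0) < Kerr.radius (ac i) (p i x)} ⊆ ↑U₀ ∧ S.IsLateChart B₀ O' τ₂ Ψ₀ ∧ Tendsto (S.deviationCk B₀ Ψ₀ 2) atTop (𝓝 0) ∧ O' \ ((⋃ i, Ψ' i '' (Bf i).lateRegion τ₂) ∪ Ψ₀ '' B₀.lateRegion τ₂) ⊆ J ((⋃ i, Ψ' i '' (Bf i).timeSlab τ₂) ∪ Ψ₀ '' B₀.timeSlab τ₂) ∧ RaysStayInClosure 𝒞 (exteriorOf 𝒞 (Ψ₀ '' B₀.lateRegion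 τ₂)) ∧ (∀ i (ϱ : ℝ), ∀ᶠ τ in atTop, ∀ x ∈ (Bf i).truncTimeSlab ϱ τ, 𝒟.timeOrientation.IsFutureDirected (mfderiv 𝓘(ℝ, E4) (𝓡 4) (Ψ' i) x (L i (Kerr.timeVector (Mc i) (ac i) (p i x.1))))) ∧ (∀ᶠ τ in atTop, ∀ x ∈ B₀.timeSlab τ, 𝒟.timeOrientation.IsFutureDirected (mfderiv 𝓘(ℝ, E4) (𝓡 4) Ψ₀ x (E4.basisVector 0))) ∧ ∃ R : Fin N → ℝ → ℝ, (∀ i, Tendsto (fun τ ↦ S.truncDeviationCk (Bf i) (Ψ' i) 2 (R i τ) τ) atTop (𝓝 0)) ∧ ∀ τ' > τ₂, O' \ (Ψ₀ '' B₀.lateRegion τ' ∪ ⋃ i, Ψ' i '' {x | τ' < (Bf i).time x.1 ∧ (Bf i).radius x.1 ≤ R i ((Bf i).time x.1)}) ⊆ J (Ψ₀ '' B₀.timeSlab τ' ∪ ⋃ i, Ψ' i '' (Bf i).truncTimeSlab (R i τ') τ')) := by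
  sorry

/-- **P — PACKAGING A FROZEN ANCHORED ERA + HONEST RADII** (M; provable now).  A frozen anchored era (verbatim the
conclusion of T, for arbitrary `N, m₀, χ, τ₂, Mc, ac, motion, Ψ′, ρ, U₀, Ψ₀`) yields the conclusion of `Reanchoring`: take
`O′` as displayed and `d := ⟨N, Mc, ac, _, _, motion, τ₂, Ψ′, _, _, _, ρ, _, U₀, _, Ψ₀, _, _, _⟩ : FinalStateDecomposition 𝒟.toSpacetime O′ 2`
(every field is a clause; `mass_pos`/`abs_spin_le_mass`/`Kerr.IsSubextremal` from `0 < m₀ ≤ Mc i`, `|ac i| ≤ χ Mc i`, `χ < 1`); then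
`O′ = exteriorOf 𝒟 d.charted` is definitional (`d.charted = Ψ₀ '' {x⁰ > τ₂} ∪ ⋃ᵢ Ψ′ i '' {t*ᵢ > τ₂}`), `RaysStayInClosure 𝒟 O′` follows from the
rays clause by monotonicity of `exteriorOf` (chronological pasts are monotone) and of `closure`, `IsFutureOriented d` is the
orthochronous clause (`IsOrthochronous` by `Iff.rfl`) and the two orientation clauses, and `HasExhaustiveCharts d` is the `Q′`-shaped
exhaustiveness clause UPGRADED to honest radii: with `G i τ → ∞` slowly enough that `truncDeviationCk … 2 (G i τ) τ → 0` (diagonal over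
the fixed-radius convergence for every `R`), put `R′ i τ := max (R i τ) (max (G i τ) (max (r₊(Mc i, ac i)) 0 + 1))`; the sup over a
union of truncations is the max of the sups, and both sides of the causal clause are monotone in the radius (`certifiedLate` grows,
`certifiedSlab` grows).  Why it might fail: only plumbing — `let`-unfolding of `d.background i = boostedKerrBackground …`, the
`ENNReal`-valued diagonal lemma, `Disjoint on` vs `Function.onFun`.  Leans on: `FinalStateDecomposition` (fields), `HasExhaustiveCharts`,
`certifiedLate`, `certifiedSlab`, `IsFutureOriented`, `IsOrthochronous`, `truncDeviationCk_mono`, `supCkENorm_mono`.  Sources: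
DafermosLuk2017 (Conj. 1 (b)–(c)), arXiv:2104.08222 (§1), doi:10.1007/s00220-002-0723-2 (diagonal/almost-monotone bookkeeping as in
`AlmostMonotoneLimit`).  Size: M. -/
theorem stub_packageDecomposition : open Literature.Geometry.Lorentzian Summit.FinalStateConjecture in ∀ (X : Type) [TopologicalSpace X] [ChartedSpace E3 X] [IsManifold (𝓡 3) (⊤ : ℕ∞) X] [T2Space X] [SecondCountableTopology X] [ConnectedSpace X], ∀ D ∈ admissibleVacuumData X, ∀ 𝒟 : VacuumCauchyDevelopment D, 𝒟.IsMaximal → HasCompleteNullInfinity 𝒟.toCauchyDevelopment → ∀ (N : ℕ) (m₀ χ τ₂ : ℝ) (Mc ac : Fin N → ℝ) (motion : Fin N → lorentzGroup × E4) (Ψ' : ∀ i, ↥(boostedKerrBackground (motion i).1 (motion i).2 (Mc i) (ac i)).domain → 𝒟.carrier) (ρ : Fin N → ℝ → ℝ) (U₀ : Opens E4) (Ψ₀ : U₀ → 𝒟.carrier), (let S := 𝒟.toSpacetime; let 𝒞 := 𝒟.toCauchyDevelopment; let J := 𝒟.metric.causalPast 𝒟.timeOrientation; let L := fun i ↦ ((motion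 i).1 : E4 ≃L[ℝ] E4); let p := fun i ↦ poincareInv (motion i).1 (motion i).2; let e := fun i ↦ L i (E4.basisVector 0); let Bf : Fin N → ModelBackground := fun i ↦ boostedKerrBackground (motion i).1 (motion i).2 (Mc i) (ac i); let B₀ := Minkowski.backgroundOn U₀; let O' := exteriorOf 𝒞 (Ψ₀ '' B₀.lateRegion τ₂ ∪ ⋃ i, Ψ' i '' (Bf i).lateRegion τ₂); (0 < m₀ ∧ 0 ≤ χ ∧ χ < 1 ∧ ∀ i, m₀ ≤ Mc i ∧ |ac i| ≤ χ * Mc i) ∧ (∀ i, 0 < e i 0) ∧ (∀ i, S.IsLateChart (Bf i) O' τ₂ (Ψ' i)) ∧ (∀ i (R : ℝ), Tendsto (S.truncDeviationCk (Bf i) (Ψ' i) 2 R) atTop (𝓝 0)) ∧ (∀ R : ℝ, ∃ τ₃, Pairwise (Disjoint on fun i ↦ Ψ' i '' (Bf i).truncLateRegion τ₃ R)) ∧ (∀ i, Tendsto (fun t ↦ ρ i t / t) atTop (𝓝 0)) ∧ {x : E4 | τ₂ < x 0 ∧ ∀ i, ρ i (x 0) < Kerr.radius (ac i) (p i x)}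 ⊆ ↑U₀ ∧ S.IsLateChart B₀ O' τ₂ Ψ₀ ∧ Tendsto (S.deviationCk B₀ Ψ₀ 2) atTop (𝓝 0) ∧ O' \ ((⋃ i, Ψ' i '' (Bf i).lateRegion τ₂) ∪ Ψ₀ '' B₀.lateRegion τ₂) ⊆ J ((⋃ i, Ψ' i '' (Bf i).timeSlab τ₂) ∪ Ψ₀ '' B₀.timeSlab τ₂) ∧ RaysStayInClosure 𝒞 (exteriorOf 𝒞 (Ψ₀ '' B₀.lateRegion τ₂)) ∧ (∀ i (ϱ : ℝ), ∀ᶠ τ in atTop, ∀ x ∈ (Bf i).truncTimeSlab ϱ τ, 𝒟.timeOrientation.IsFutureDirected (mfderiv 𝓘(ℝ, E4) (𝓡 4) (Ψ' i) x (L i (Kerr.timeVector (Mc i) (ac i) (p i x.1))))) ∧ (∀ᶠ τ in atTop, ∀ x ∈ B₀.timeSlab τ, 𝒟.timeOrientation.IsFutureDirected (mfderiv 𝓘(ℝ, E4) (𝓡 4) Ψ₀ x (E4.basisVector 0))) ∧ ∃ R : Fin N → ℝ → ℝ, (∀ i, Tendsto (fun τ ↦ S.truncDeviationCk (Bf i)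 (Ψ' i) 2 (R i τ) τ) atTop (𝓝 0)) ∧ ∀ τ' > τ₂, O' \ (Ψ₀ '' B₀.lateRegion τ' ∪ ⋃ i, Ψ' i '' {x | τ' < (Bf i).time x.1 ∧ (Bf i).radius x.1 ≤ R i ((Bf i).time x.1)}) ⊆ J (Ψ₀ '' B₀.timeSlab τ' ∪ ⋃ i, Ψ' i '' (Bf i).truncTimeSlab (R i τ') τ')) → ∃ (O' : Set 𝒟.carrier) (d : FinalStateDecomposition 𝒟.toSpacetime O' 2), (∀ i, Kerr.IsSubextremal (d.mass i) (d.spin i)) ∧ O' = exteriorOf 𝒟.toCauchyDevelopment d.charted ∧ RaysStayInClosure 𝒟.toCauchyDevelopment O' ∧ HasExhaustiveCharts d ∧ IsFutureOriented d := by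
  sorry

/-! ## Composition: the crux BY NAME from the three stubs (real proof, no `sorry`) -/

/-- **R from H, T and P**: name the label limits (`choose`), straighten the horizons (H), transport the drifting era to the
frozen anchored era in the straightened charts (T), and package it (P); the conclusion of P is the conclusion of `Reanchoring`
verbatim. -/
theorem Reanchoring_of :
    Sig.stub_horizonStraightening → Sig.stub_frozenTransport → Sig.stub_packageDecomposition →
      Reanchoring := by
  intro hH hT hP X _ _ _ _ _ _ D hD 𝒟 hmax hscri N m₀ χ τ₀ δ₀ M a motion U Ψ ρ U₀ Ψ₀ O hQ hM ha
  -- the label limits, as functions of the hole index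
  choose Mc hMc using hM
  choose ac hac using ha
  -- H: a late straightening package anchored to `O`
  obtain ⟨τ₁, Φ, hτ₁, hΦ⟩ :=
    hH X D hD 𝒟 hmax hscri N m₀ χ τ₀ δ₀ M a motion U Ψ ρ U₀ Ψ₀ O hQ Mc ac hMc hac
  -- T: the frozen anchored era in the re-anchored charts
  obtain ⟨τ₂, Ψ', hF⟩ :=
    hT X D hD 𝒟 hmax hscri N m₀ χ τ₀ δ₀ M a motion U Ψ ρ U₀ Ψ₀ O hQ Mc ac hMc hac τ₁ Φ hτ₁ hΦ
  -- P: package it into the Statement's settling clause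
  exact hP X D hD 𝒟 hmax hscri N m₀ χ τ₂ Mc ac motion Ψ' ρ U₀ Ψ₀ hF

/-- The crux by name, closed modulo the three registered stubs. -/
theorem reanchoring_of_stubs : Reanchoring :=
  Reanchoring_of stub_horizonStraightening stub_frozenTransport stub_packageDecomposition

end Summit.FinalStateConjecture.FinalStateConjecture.Cruxes.Reanchoring.Birth

end
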